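import Literature.Computability.AlgebraicComplexity.TensorPowerAction
import Literature.Computability.AlgebraicComplexity.TensorMomentMatrix
import Literature.Computability.AlgebraicComplexity.StandardFamilies
import HarnessLib

/-!
# The determinant and permanent tensors have polynomial shadows `det_n` and `per_n`

Support file for the proof of Bürgisser–Ikenmeyer 2017, Cor. 2.9 (`det_n` and `per_n` are
polystable, `Polystability.lean`). With the tensor power action and the polynomial shadow
`tensorToPoly` of `TensorPowerAction.lean` and the pattern tensors of `TensorMomentMatrix.lean`
we prove

* `tensorToPoly_patternTensor` — `tensorToPoly (patternTensor χ) = ∑ τ, χ τ · ∏ i, X (τ i, i)`;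
* `tensorToPoly_detTensor` — `tensorToPoly (detTensor n) = detPoly (Fin n) ℂ`;
* `tensorToPoly_perTensor` — `tensorToPoly (perTensor n) = perPoly (Fin n) ℂ`.

Hence (by `tensorToPoly_tensorAct`) the `SL_{n²}`-orbits of `det_n`, `per_n` under linear
substitution are the polynomial shadows of the tensor orbits of `detTensor n`, `perTensor n`.
Everything is proved; [folklore].
-/

noncomputable section

open MvPolynomial Finset

namespace Literature.Computability.AlgebraicComplexity

variable {n : ℕ}

/-- **The polynomial shadow of a pattern tensor**:
`tensorToPoly (patternTensor χ) = ∑ τ, χ τ · ∏ i, X (τ i, i)` (the `n!` pattern words of each `τ`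
all carry the same monomial). [folklore] -/
theorem tensorToPoly_patternTensor (χ : Equiv.Perm (Fin n) → ℂ) :
    tensorToPoly (patternTensor χ) =
      ∑ τ : Equiv.Perm (Fin n), C (χ τ) * ∏ i, (X (τ i, i) : MvPolynomial (Fin n × Fin n) ℂ) := by
  rw [tensorToPoly_apply]
  have hexp : ∀ j : Fin n → Fin n × Fin n,
      C (patternTensor χ j) * ∏ k, (X (j k) : MvPolynomial (Fin n × Fin n) ℂ) =
        ∑ r : Equiv.Perm (Fin n), ∑ τ : Equiv.Perm (Fin n),
          if j = detPattern r τ then C ((Nat.factorial n : ℂ)⁻¹ * χ τ) * ∏ k, X (j k) else 0 := by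
    intro j
    rw [patternTensor_apply, Finset.mul_sum, map_sum, Finset.sum_mul]
    refine Finset.sum_congr rfl fun r _ => ?_
    rw [Finset.mul_sum, map_sum, Finset.sum_mul]
    refine Finset.sum_congr rfl fun τ _ => ?_
    by_cases h : j = detPattern r τ
    · rw [if_pos h, if_pos h]
    · rw [if_neg h, if_neg h, mul_zero, C_0, zero_mul]
  simp_rw [hexp]
  rw [Finset.sum_comm]
  have hin : ∀ r : Equiv.Perm (Fin n),
      (∑ j : Fin n → Fin n × Fin n, ∑ τ : Equiv.Perm (Fin n),
        if j = detPattern r τ then C ((Nat.factorial n : ℂ)⁻¹ * χ τ) * ∏ k, X (j k) else 0) =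
        ∑ τ : Equiv.Perm (Fin n), C ((Nat.factorial n : ℂ)⁻¹ * χ τ) *
          ∏ i, (X (τ i, i) : MvPolynomial (Fin n × Fin n) ℂ) := by
    intro r
    rw [Finset.sum_comm]
    refine Finset.sum_congr rfl fun τ _ => ?_
    rw [Finset.sum_ite_eq' Finset.univ (detPattern r τ), if_pos (Finset.mem_univ _)]
    congr 1
    exact Equiv.prod_comp r (fun i => (X (τ i, i) : MvPolynomial (Fin n × Fin n) ℂ))
  simp_rw [hin]
  rw [Finset.sum_const, Finset.card_univ, Fintype.card_perm, Fintype.card_fin, Finset.smul_sum]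
  refine Finset.sum_congr rfl fun τ _ => ?_
  rw [map_mul, nsmul_eq_mul, ← mul_assoc, ← mul_assoc]
  congr 1
  rw [← map_natCast (C : ℂ →+* MvPolynomial (Fin n × Fin n) ℂ), ← map_mul, ← map_mul]
  congr 1
  rw [mul_inv_cancel₀ (Nat.cast_ne_zero.mpr (Nat.factorial_ne_zero n)), one_mul]

/-- **The determinant tensor represents `det_n`**: `tensorToPoly (detTensor n) = detPoly (Fin n) ℂ`
(Leibniz expansion, `Matrix.det_apply`). [folklore] -/
theorem tensorToPoly_detTensor (n : ℕ) : tensorToPoly (detTensor n) = detPoly (Fin n) ℂ := by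
  rw [detTensor, tensorToPoly_patternTensor, detPoly, Matrix.det_apply]
  refine Finset.sum_congr rfl fun τ _ => ?_
  rw [Units.smul_def, zsmul_eq_mul, ← map_intCast (C : ℂ →+* MvPolynomial (Fin n × Fin n) ℂ)]
  rfl

/-- **The permanent tensor represents `per_n`**: `tensorToPoly (perTensor n) = perPoly (Fin n) ℂ`.
[folklore] -/
theorem tensorToPoly_perTensor (n : ℕ) : tensorToPoly (perTensor n) = perPoly (Fin n) ℂ := by
  rw [perTensor, tensorToPoly_patternTensor, perPoly, Matrix.permanent]
  refine Finset.sum_congr rfl fun τ _ => ?_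
  rw [C_1, one_mul]
  rfl


end Literature.Computability.AlgebraicComplexity
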